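import Summits.CriticalPhenomena.PercolationContinuityZ3.Theorems.PercNearOneGluingNoHeavyQuantGatedSliceMixLawCells
import Summits.CriticalPhenomena.PercolationContinuityZ3.Theorems.PercNearOneGluingNoHeavyQuantGatedSliceMixLawC2
import Summits.CriticalPhenomena.PercolationContinuityZ3.Theorems.PercNearOneGluingNoHeavyQuantGatedSliceMixLawC4
import Summits.CriticalPhenomena.PercolationContinuityZ3.Theorems.PercNearOneGluingNoHeavyQuantGatedSliceWindowReductionPrime
import HarnessLib

/-!
# QUANT lane R8, T-DEC, leg (III), blob case — `LawDec.GatedSliceMixLaw'` ASSEMBLED FROM ITS CELLS: the Q-alone cells and regime B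
# (`…QuantGatedSliceMixLawCells`) together with the typer's kernel regimes C1–C4 give `GatedSliceMixLaw'` (hence CW and the blob case of
# leg (III) by `…ReductionPrime` / `…WindowMixOfMixLaw`)

builds on p205010 (kernel theorem, internal audit signed; external expert review pending)

Support file (`--supports stmt-CriticalPhenomena-4575`), QUANT lane typer seat prim-quant-stmt (gen 30), rung R8 of
`run/shared/lean/prim/quant/LADDER.md`.  Memo `run/shared/lean/prim/quant/prim-quant-stmt-g30/MIXLAW-MIXTURES-G30.md` §6.  Theorems only,
standard axioms, no sorries; CONDITIONAL on the `@[conjecture]` cells of `…QuantGatedSliceMixLawCells` (taken as hypotheses).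

THE CASE TREE (frame of `GatedSliceMixLaw'`, `t = S + ag(1−z)`, `ℓ = k₁ + a`): `2S < t` → QH | `k₁` not a `t`-low → Q2 | `k₂ + a ≤ j` → Q1 |
`ℓ ≥ j+1` → the moved law is DEC by criterion E (`decAtT_movedTwoPoint_of_twin_giant`, this file) | `h + a ≥ j+1` → REGIME B | otherwise regime A:
`ℓ` a `t`-low: `k₂ ≥ j+1` → C1, `k₂` a `t`-low → QK, `ℓ + k₂ ≤ t` → QD, `k₂` a saturated mid → C2, unsaturated → Q3; `ℓ` not a `t`-low: `ℓ ≤ t`: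
`k₂ ≥ j+1` → C3 else Q4; `ℓ > t`: `k₂ ≥ j+1`: saturated twin → C4, else Q4′; `k₂ ≤ j` → Q4.

* `LawDec.decAtT_movedTwoPoint_of_twin_giant` — `ℓ = k₁ + a ≥ j + 1` ⟹ the moved two-point law is DEC (criterion E: the giants carry
  `(1−z)g ≥ y`).
* `LawDec.gatedSliceMixLaw_of_decP` — a DEC moved law gives the conclusion of `GatedSliceMixLaw'` with `θ = 0`.
* **`LawDec.gatedSliceMixLaw'_of_cells`** — `MixLawCellQ1 → MixLawCellQ2 → MixLawCellQ3 → MixLawCellQ4 → MixLawCellQ4p → MixLawCellQH →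
  MixLawCellQK → MixLawCellQD → MixLawRegimeB → GatedSliceMixLaw'`.
* `LawDec.gatedSliceWindowDEC_of_cells`, `LawDec.sdecUpTo_slice_blob_of_cells` — hence CW (`GatedSliceWindowDEC`) and the closure of
  `SDECUpTo` under slicing by any heavy blob (the blob case of leg (III)), by typer g29's `…ReductionPrime`.

[this work]; regimes C1–C4: this seat; Q-alone cells: arm-1 g41 / arm-2; regime B: census-2 g60 (lead g32 ruling).  The gluing rows served
[cite: KozmaNitzan2024, Conjecture 3 (p. 15)]; product measure [cite: Grimmett1999, §1.3 p. 10].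
-/

noncomputable section

namespace Summit.CriticalPhenomena.PercolationContinuityZ3.Theorems

namespace Quant

open Finset

/-- the two-point law `{lo, hi; g}` (as in `…QuantLawDEC`) -/
local notation3 "TP[" lo ", " hi ", " g ", " h "]" =>
  (g : ℝ) * (if (h : ℕ) = (hi : ℕ) then (1 : ℝ) else 0) + (1 - (g : ℝ)) * (if (h : ℕ) = (lo : ℕ) then (1 : ℝ) else 0)

namespace LawDec

/-- **`θ = 0`**: if the moved two-point law is DEC, the conclusion of `GatedSliceMixLaw'` holds. [this work] -/
theorem gatedSliceMixLaw_of_decP (y z g S lam : ℝ) (a j M h k₁ k₂ : ℕ)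
    (hP : DECAtT y (S + (a : ℝ) * g * (1 - z)) j (M + a)
      (fun p => z * (if p = 0 then (1 : ℝ) else 0) + (1 - z) * slice (fun q => TP[k₁, k₂, lam, q]) a g p)) :
    ∃ θ : ℝ, 0 ≤ θ ∧ θ < 1 ∧
      DECAtT y (S + (a : ℝ) * g * (1 - z)) j (M + a)
        (fun p => θ * weakMidLaw S g h a p
          + (1 - θ) * (z * (if p = 0 then (1 : ℝ) else 0) + (1 - z) * slice (fun q => TP[k₁, k₂, lam, q]) a g p)) := by
  refine ⟨0, le_rfl, zero_lt_one, ?_⟩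
  have e : (fun p => (0 : ℝ) * weakMidLaw S g h a p
      + (1 - 0) * (z * (if p = 0 then (1 : ℝ) else 0) + (1 - z) * slice (fun q => TP[k₁, k₂, lam, q]) a g p))
      = fun p => z * (if p = 0 then (1 : ℝ) else 0) + (1 - z) * slice (fun q => TP[k₁, k₂, lam, q]) a g p := by
    funext p; ring
  rw [e]; exact hP

/-- **the twin a giant ⟹ the moved law is DEC** (`k₁ + a ≥ j+1`; frame `0 < y < 1`, `0 ≤ z < 1`, `g ≤ 1`, `y ≤ (1−z)g`, `k₁ ≤ k₂ ≤ M`,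
`0 ≤ λ ≤ 1`): the giants `k₁ + a`, `k₂ + a` carry `(1−z)g`, every other atom at most `1 − (1−z)g ≤ 1 − y`, so criterion E holds. [this work] -/
theorem decAtT_movedTwoPoint_of_twin_giant (y z g S lam : ℝ) (a j M k₁ k₂ : ℕ)
    (hy0 : 0 < y) (hy1 : y < 1) (hz0 : 0 ≤ z) (hz1 : z < 1) (hg1 : g ≤ 1) (hyg : y ≤ (1 - z) * g)
    (hk : k₁ ≤ k₂) (hk₂M : k₂ ≤ M) (hlam0 : 0 ≤ lam) (hlam1 : lam ≤ 1) (hlG : j + 1 ≤ k₁ + a) :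
    DECAtT y (S + (a : ℝ) * g * (1 - z)) j (M + a)
      (fun p => z * (if p = 0 then (1 : ℝ) else 0) + (1 - z) * slice (fun q => TP[k₁, k₂, lam, q]) a g p) := by
  classical
  set t : ℝ := S + (a : ℝ) * g * (1 - z) with ht
  have h1z : 0 < 1 - z := by linarith
  have hg0 : 0 < g := by nlinarith
  have h1y : 0 < 1 - y := by linarith
  have h1lam : 0 ≤ 1 - lam := by linarith
  have hm₁0 : 0 ≤ (1 - z) * (1 - lam) * (1 - g) := mul_nonneg (mul_nonneg h1z.le h1lam) (by linarith)
  have hm₁'0 : 0 ≤ (1 - z) * (1 - lam) * g := mul_nonneg (mul_nonneg h1z.le h1lam) hg0.le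
  have hm₂0 : 0 ≤ (1 - z) * lam * (1 - g) := mul_nonneg (mul_nonneg h1z.le hlam0) (by linarith)
  have hm₂'0 : 0 ≤ (1 - z) * lam * g := mul_nonneg (mul_nonneg h1z.le hlam0) hg0.le
  have hPnn : ∀ p, 0 ≤ z * (if p = 0 then (1 : ℝ) else 0) + (1 - z) * slice (fun q => TP[k₁, k₂, lam, q]) a g p := by
    intro p; rw [movedTwoPoint_apply]
    refine add_nonneg (add_nonneg (add_nonneg (add_nonneg (mul_nonneg hz0 ?_) (mul_nonneg hm₁0 ?_)) (mul_nonneg hm₁'0 ?_))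
      (mul_nonneg hm₂0 ?_)) (mul_nonneg hm₂'0 ?_) <;> split_ifs <;> norm_num
  -- the part of the law below the layer: at most z + m₁ + m₂ = 1 − (1−z)g
  have hPlow : ∀ l, l ≤ j →
      z * (if l = 0 then (1 : ℝ) else 0) + (1 - z) * slice (fun q => TP[k₁, k₂, lam, q]) a g l
        = z * (if l = 0 then (1 : ℝ) else 0) + (1 - z) * (1 - lam) * (1 - g) * (if l = k₁ then (1 : ℝ) else 0)
          + (1 - z) * lam * (1 - g) * (if l = k₂ then (1 : ℝ) else 0) := by
    intro l hl
    rw [movedTwoPoint_apply, if_neg (show l ≠ k₁ + a by omega), if_neg (show l ≠ k₂ + a by omega)]; ring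
  set X : ℝ := ∑ l ∈ Finset.range (j + 1),
      (z * (if l = 0 then (1 : ℝ) else 0) + (1 - z) * slice (fun q => TP[k₁, k₂, lam, q]) a g l) with hX
  have hXle : X ≤ z + (1 - z) * (1 - lam) * (1 - g) + (1 - z) * lam * (1 - g) := by
    rw [hX, Finset.sum_congr rfl (fun l hl => hPlow l (Nat.lt_succ_iff.1 (Finset.mem_range.1 hl)))]
    rw [Finset.sum_add_distrib, Finset.sum_add_distrib, sum_mul_indicator (fun _ => z) j 0 (by omega)]
    have b1 : ∑ l ∈ Finset.range (j + 1), (1 - z) * (1 - lam) * (1 - g) * (if l = k₁ then (1 : ℝ) else 0)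
        ≤ (1 - z) * (1 - lam) * (1 - g) := by
      rw [← Finset.mul_sum]
      refine mul_le_of_le_one_right hm₁0 ?_
      rw [Finset.sum_ite_eq']; split_ifs <;> norm_num
    have b2 : ∑ l ∈ Finset.range (j + 1), (1 - z) * lam * (1 - g) * (if l = k₂ then (1 : ℝ) else 0)
        ≤ (1 - z) * lam * (1 - g) := by
      rw [← Finset.mul_sum]
      refine mul_le_of_le_one_right hm₂0 ?_
      rw [Finset.sum_ite_eq']; split_ifs <;> norm_num
    linarith
  have hX0 : 0 ≤ X := Finset.sum_nonneg fun l _ => hPnn l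
  have hsumall := sum_movedTwoPoint z lam g a k₁ k₂ (M + a) hk (by omega)
  have hIco : ∑ p ∈ Finset.Ico (j + 1) (M + a + 1),
      (z * (if p = 0 then (1 : ℝ) else 0) + (1 - z) * slice (fun q => TP[k₁, k₂, lam, q]) a g p) = 1 - X := by
    have := Finset.sum_range_add_sum_Ico (fun p =>
      z * (if p = 0 then (1 : ℝ) else 0) + (1 - z) * slice (fun q => TP[k₁, k₂, lam, q]) a g p) (show j + 1 ≤ M + a + 1 by omega)
    rw [hsumall] at this
    linarith
  refine decAtT_of_flowAtT y t j (M + a) _ hy0 hy1 (fun p hp => movedTwoPoint_eq_zero z lam g a k₁ k₂ p hk (by omega)) hsumall ?_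
  refine flowAtT_of_giants y t j (M + a) _ hy0 hy1 hPnn ?_
  rw [hIco]
  have hlow : ∑ l ∈ Finset.range (j + 1), (if 2 * (l : ℝ) < t then
      z * (if l = 0 then (1 : ℝ) else 0) + (1 - z) * slice (fun q => TP[k₁, k₂, lam, q]) a g l else 0) ≤ X := by
    rw [hX]
    exact Finset.sum_le_sum fun l _ => by
      by_cases h2 : 2 * (l : ℝ) < t
      · rw [if_pos h2]
      · rw [if_neg h2]; exact hPnn l
  have key : y / (1 - y) * X ≤ 1 - X := by
    rw [div_mul_eq_mul_div, div_le_iff₀ h1y]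
    have : X ≤ 1 - y := by
      have e : z + (1 - z) * (1 - lam) * (1 - g) + (1 - z) * lam * (1 - g) = 1 - (1 - z) * g := by ring
      rw [e] at hXle; linarith
    nlinarith
  exact le_trans (mul_le_mul_of_nonneg_left hlow (div_pos hy0 h1y).le) key

/-! ### The assembly -/

set_option maxHeartbeats 800000 in
/-- **`GatedSliceMixLaw'` FROM ITS CELLS**: the Q-alone cells and regime B of `…QuantGatedSliceMixLawCells`, together with the kernel regimes
C1–C4 of this seat and the twin-giant cell above, give `GatedSliceMixLaw'` by the case tree of the file header. [this work] -/
theorem gatedSliceMixLaw'_of_cells (hQ1 : MixLawCellQ1) (hQ2 : MixLawCellQ2) (hQ3 : MixLawCellQ3) (hQ4 : MixLawCellQ4)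
    (hQ4p : MixLawCellQ4p) (hQH : MixLawCellQH) (hQK : MixLawCellQK) (hQD : MixLawCellQD) (hB : MixLawRegimeB) :
    GatedSliceMixLaw' := by
  intro y z g S lam a j M h k₁ k₂ hy0 hy1 hz0 hz1 hg1 hyg ha hjM hS0 hta hhj hhM hSh hW hk hk₂M hlam0 hlam1 hmean
  have hSj : S < (j : ℝ) := lt_of_lt_of_le hSh (by exact_mod_cast hhj)
  have hSM : S < (M : ℝ) := lt_of_lt_of_le hSh (by exact_mod_cast hhM)
  have conc := gatedSliceMixLaw_of_decP y z g S lam a j M h k₁ k₂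
  -- QH: the blob dominates the mean (covers `h` a `t`-low)
  by_cases hQHc : 2 * S < S + (a : ℝ) * g * (1 - z)
  · exact conc (hQH y z g S lam a j M k₁ k₂ hy0 hy1 hz0 hz1 hg1 hyg ha hjM hS0 hta hSj hSM hk hk₂M hlam0 hlam1 hmean hQHc)
  have hhmid : S + (a : ℝ) * g * (1 - z) ≤ 2 * (h : ℝ) := by linarith
  -- Q2: k₁ not a t-low
  by_cases hk1low : k₁ ≤ j ∧ 2 * (k₁ : ℝ) < S + (a : ℝ) * g * (1 - z)
  swap
  · exact conc (hQ2 y z g S lam a j M k₁ k₂ hy0 hy1 hz0 hz1 hg1 hyg ha hjM hS0 hta hSj hSM hk hk₂M hlam0 hlam1 hmean hk1low)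
  obtain ⟨hk₁j, hk₁low⟩ := hk1low
  -- Q1: no giant
  by_cases hQ1c : k₂ + a ≤ j
  · exact conc (hQ1 y z g S lam a j M k₁ k₂ hy0 hy1 hz0 hz1 hg1 hyg ha hjM hS0 hta hSj hSM hk hk₂M hlam0 hlam1 hmean hQ1c)
  have hk₂aG : j + 1 ≤ k₂ + a := by omega
  -- twin a giant
  by_cases hlG : j + 1 ≤ k₁ + a
  · exact conc (decAtT_movedTwoPoint_of_twin_giant y z g S lam a j M k₁ k₂ hy0 hy1 hz0 hz1 hg1 hyg hk hk₂M hlam0 hlam1 hlG)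
  have hlj : k₁ + a ≤ j := by omega
  -- regime B
  by_cases hBc : j + 1 ≤ h + a
  · exact hB y z g S lam a j M h k₁ k₂ hy0 hy1 hz0 hz1 hg1 hyg ha hjM hS0 hta hhj hhM hSh hW hk hk₂M hlam0 hlam1 hmean hk₁j hk₁low hlj
      hk₂aG (by linarith) hBc
  have hhaj : h + a ≤ j := by omega
  -- regime A
  by_cases hllow : 2 * ((k₁ + a : ℕ) : ℝ) < S + (a : ℝ) * g * (1 - z)
  · -- the shifted low is a t-low
    by_cases hk₂G : j + 1 ≤ k₂
    · exact gatedSliceMixLaw_regimeC1 y z g S lam a j M h k₁ k₂ hy0 hy1 hz0 hz1 hg1 hyg hjM hS0 hta hhM hSh hk hk₂M hlam0 hlam1 hmean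
        hllow hlj hk₂G hhaj hhmid
    have hk₂j : k₂ ≤ j := by omega
    by_cases hk₂low : 2 * (k₂ : ℝ) < S + (a : ℝ) * g * (1 - z)
    · exact conc (hQK y z g S lam a j M k₁ k₂ hy0 hy1 hz0 hz1 hg1 hyg ha hjM hS0 hta hSj hSM hk hk₂M hlam0 hlam1 hmean hk₂j hk₂low)
    have hk₂mid : S + (a : ℝ) * g * (1 - z) ≤ 2 * (k₂ : ℝ) := not_lt.1 hk₂low
    by_cases hcomp : S + (a : ℝ) * g * (1 - z) < ((k₁ + a : ℕ) : ℝ) + k₂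
    swap
    · exact conc (hQD y z g S lam a j M k₁ k₂ hy0 hy1 hz0 hz1 hg1 hyg ha hjM hS0 hta hSj hSM hk hk₂M hlam0 hlam1 hmean (not_lt.1 hcomp))
    by_cases hsat : (1 - z) * lam * (1 - g) ≤ (1 - z) * (1 - lam) * g * usage y (S + (a : ℝ) * g * (1 - z)) j (k₁ + a) k₂
    · exact gatedSliceMixLaw_regimeC2 y z g S lam a j M h k₁ k₂ hy0 hy1 hz0 hz1 hg1 hyg hjM hS0 hta hhM hSh hk hk₂M hlam0 hlam1 hmean
        hllow hlj hk₂j hk₂mid hcomp hk₂aG hhaj hhmid hsat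
    · exact conc (hQ3 y z g S lam a j M k₁ k₂ hy0 hy1 hz0 hz1 hg1 hyg ha hjM hS0 hta hSj hSM hk hk₂M hlam0 hlam1 hmean hllow hlj hk₂j
        hk₂mid hcomp hk₂aG (not_le.1 hsat).le)
  · -- the twin is not a t-low
    have hlmid : S + (a : ℝ) * g * (1 - z) ≤ 2 * ((k₁ + a : ℕ) : ℝ) := not_lt.1 hllow
    by_cases hlt : ((k₁ + a : ℕ) : ℝ) ≤ S + (a : ℝ) * g * (1 - z)
    · by_cases hk₂G : j + 1 ≤ k₂
      · exact gatedSliceMixLaw_regimeC3 y z g S lam a j M h k₁ k₂ hy0 hy1 hz0 hz1 hg1 hyg hS0 hta hhM hSh hk hk₂M hlam0 hlam1 hmean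
          hk₁low hlj hlmid hlt hk₂G hhaj hhmid
      · exact conc (hQ4 y z g S lam a j M k₁ k₂ hy0 hy1 hz0 hz1 hg1 hyg ha hjM hS0 hta hSj hSM hk hk₂M hlam0 hlam1 hmean hk₁j hk₁low
          hlj hlmid (by omega))
    · have hlt' : S + (a : ℝ) * g * (1 - z) < ((k₁ + a : ℕ) : ℝ) := not_le.1 hlt
      by_cases hk₂G : j + 1 ≤ k₂
      · by_cases hsat : (1 - z) * (1 - lam) * g ≤ (1 - z) * (1 - lam) * (1 - g) * usage y (S + (a : ℝ) * g * (1 - z)) j k₁ (k₁ + a)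
        · exact gatedSliceMixLaw_regimeC4 y z g S lam a j M h k₁ k₂ hy0 hy1 hz0 hz1 hg1 hyg hS0 hta hhM hSh hk hk₂M hlam0 hlam1 hmean
            hk₁low hlj hlt' hsat hk₂G hhaj hhmid
        · exact conc (hQ4p y z g S lam a j M k₁ k₂ hy0 hy1 hz0 hz1 hg1 hyg ha hjM hS0 hta hSj hSM hk hk₂M hlam0 hlam1 hmean hk₁j hk₁low
            hlj hlt' hk₂G (not_le.1 hsat).le)
      · exact conc (hQ4 y z g S lam a j M k₁ k₂ hy0 hy1 hz0 hz1 hg1 hyg ha hjM hS0 hta hSj hSM hk hk₂M hlam0 hlam1 hmean hk₁j hk₁low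
          hlj hlmid (by omega))

/-- **CW FROM THE CELLS**: the window form of the blob gate step follows from the residual cells (`gatedSliceWindowDEC_of_mixLaw'`). [this work] -/
theorem gatedSliceWindowDEC_of_cells (hQ1 : MixLawCellQ1) (hQ2 : MixLawCellQ2) (hQ3 : MixLawCellQ3) (hQ4 : MixLawCellQ4)
    (hQ4p : MixLawCellQ4p) (hQH : MixLawCellQH) (hQK : MixLawCellQK) (hQD : MixLawCellQD) (hB : MixLawRegimeB) :
    GatedSliceWindowDEC :=
  gatedSliceWindowDEC_of_mixLaw' (gatedSliceMixLaw'_of_cells hQ1 hQ2 hQ3 hQ4 hQ4p hQH hQK hQD hB)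

/-- **THE BLOB CASE OF LEG (III) FROM THE CELLS**: `SDECUpTo` is closed under slicing by any heavy blob (`sdecUpTo_slice_blob_of_mixLaw'`). [this work] -/
theorem sdecUpTo_slice_blob_of_cells (hQ1 : MixLawCellQ1) (hQ2 : MixLawCellQ2) (hQ3 : MixLawCellQ3) (hQ4 : MixLawCellQ4)
    (hQ4p : MixLawCellQ4p) (hQH : MixLawCellQH) (hQK : MixLawCellQK) (hQD : MixLawCellQD) (hB : MixLawRegimeB)
    (x Q g : ℝ) (M a : ℕ) (μ : ℕ → ℝ) (hx0 : 0 < x) (hQ1' : Q ≤ 1)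
    (hQx : Q * x < 1) (hxg : x ≤ g) (hg1 : g ≤ 1) (ha : 1 ≤ a) (hμ0 : ∀ h, 0 ≤ μ h) (hμM : ∀ h, M < h → μ h = 0)
    (hμ1 : ∑ h ∈ Finset.range (M + 1), μ h = 1)
    (hta : x * (M : ℝ) ≤ ∑ h ∈ Finset.range (M + 1), (h : ℝ) * μ h)
    (hS : SDECUpTo x Q M μ) :
    SDECUpTo x Q (M + a) (slice μ a g) :=
  sdecUpTo_slice_blob_of_mixLaw' (gatedSliceMixLaw'_of_cells hQ1 hQ2 hQ3 hQ4 hQ4p hQH hQK hQD hB) x Q g M a μ hx0 hQ1' hQx hxg hg1 ha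
    hμ0 hμM hμ1 hta hS

end LawDec

end Quant

end Summit.CriticalPhenomena.PercolationContinuityZ3.Theorems
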